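import Mathlib
import HarnessLib
import Summits.Ventures.LatticeQCDFlow.Scaling.AutoregressiveGaugeHeatBathColdExact
import Summits.Ventures.LatticeQCDFlow.Scaling.AutoregressiveGaugeAllClosingColdExact
import Summits.Ventures.LatticeQCDFlow.Scaling.AutoregressiveGaugeHeatBathClosingMapFloor
import Summits.Ventures.LatticeQCDFlow.Scaling.TorusRankedMorseStructure

/-!
# LatticeQCDFlow / Scaling — the closing assignment INDUCED by a total closing map, and the exact cold-start
# ratio: the one-plaquette heat bath leaves the cold configuration exactly `η` times as often as the
# all-closing sampler along the same structure

HONEST FRAMING: exact (Metropolis-corrected) sampling algorithms for lattice gauge theory;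
figures of merit are autocorrelation/cost numbers at stated couplings and volumes; no
continuum-physics claim.

Venture `LatticeQCDFlow` (cell pub-lqcd), topic `Scaling`, FANOUT row 30 (lean-1, GEN-28) — OUR WORK on
THEORY-2.md §4 row C5.  `AutoregressiveGaugeHeatBathColdExact` ∕ `AutoregressiveGaugeAllClosingColdExact`
computed the EXACT per-step escape probabilities from the cold configuration of the two exact samplers:
`Z/(c^{#B} M^k)` for the one-plaquette heat bath along a ranked `(B, t, rank)`, `Z/∏_{ℓ∈T} c_{#C_ℓ}` for the
all-closing conditioner along a closing assignment `(T, C)`.  Here the two are put on the SAME structure: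

* §1 THE INDUCED CLOSING ASSIGNMENT of a ranked structure with a total closing map `u : Bᶜ → B`
  (`AutoregressiveGaugeHeatBathClosingMapFloor.exists_closingMap_of_optimal` for optimal `B`): closing links
  `T = t(B)`, and the top link `t(a)` of `a ∈ B` closes `C_{t(a)} = {a} ∪ u⁻¹(a)` — every plaquette is scored by
  the link that closes it (**`induced_closing_eq`**, **`induced_nonempty`**, **`induced_mem_links`**,
  **`induced_disjoint`**, **`induced_cover`**, **`card_induced_links`** `#T = #B`,
  **`card_induced_closing`** `#C_{t(a)} = n_a + 1`, **`prod_induced_eq`** `∏_{ℓ∈T} c_{#C_ℓ} = ∏_{a∈B} c_{n_a+1}`);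
* §2 **`heatBath_coldRate_eq_eta_mul`** — pure arithmetic: `Z/(c^{#B} M^k) = η · Z/∏_{a∈B} c_{n_a+1}` with
  GEN-27's `η = ∏_{a∈B} c_{n_a+1}/(c·M^{n_a})` (`Σ_a n_a = k`); hence
  (**`cold_acceptMass_heatBath_eq_eta_mul_allClosing`**) for the two exact samplers built on `(B, t, u)` —
  same target, proposals `q_B` (heat bath) and `q_{T,C}` (all-closing, induced assignment) — THE COLD ACCEPTANCE
  MASSES SATISFY `A_heat-bath(cold) = η · A_all-closing(cold)` EXACTLY; `η ≤ 1` always and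
  (**`eta_lt_one`**) `η < 1` as soon as `w` is not constant and some covered plaquette closes an uncovered one
  (`k ≥ 1`): at the cold start the all-closing sampler moves strictly more often, by the factor `η⁻¹` that
  GEN-27's volume floor charges the heat bath.

NOT CLAIMED: a comparison away from the cold configuration, or of autocorrelation times.
No `def` (the induced assignment is written out as `image`∕`filter` terms), no `sorry`.
-/

noncomputable section

namespace Summit.Ventures.LatticeQCDFlow.Theory2.Autoregressive

open MeasureTheory ProbabilityTheory Function Finset
open scoped ENNReal
open Literature.MathematicalPhysics.QuantumFieldTheory Literature.MathematicalPhysics.QuantumLattice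
open Summit.Ventures.LatticeQCDFlow.Exactness Summit.Ventures.LatticeQCDFlow.Scoring

variable {d L : ℕ} [NeZero L]

/-! ## §1 The closing assignment induced by a total closing map -/

section Induced

variable (B : Finset (Plaquette d L)) (t : Plaquette d L → Edge d L) (u : Plaquette d L → Plaquette d L)

/-- **The closing set of the top link of `a ∈ B` is `{a} ∪ u⁻¹(a)`** (`t` injective on `B`, `u : Bᶜ → B`). [ours] -/
theorem induced_closing_eq (hinj : Set.InjOn t B) (huB : ∀ p' ∈ Finset.univ \ B, u p' ∈ B) {a : Plaquette d L}
    (ha : a ∈ B) :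
    B.filter (fun b => t b = t a) ∪ (Finset.univ \ B).filter (fun p' => t (u p') = t a) =
      insert a ((Finset.univ \ B).filter (fun p' => u p' = a)) := by
  ext p
  simp only [Finset.mem_union, Finset.mem_filter, Finset.mem_insert]
  constructor
  · rintro (⟨hpB, hpt⟩ | ⟨hpB, hpt⟩)
    · exact Or.inl (hinj hpB ha hpt)
    · exact Or.inr ⟨hpB, hinj (huB p hpB) ha hpt⟩
  · rintro (rfl | ⟨hpB, hpu⟩)
    · exact Or.inl ⟨ha, rfl⟩
    · exact Or.inr ⟨hpB, by rw [hpu]⟩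

/-- Every induced closing set is non-empty. [ours] -/
theorem induced_nonempty (hinj : Set.InjOn t B) (huB : ∀ p' ∈ Finset.univ \ B, u p' ∈ B) :
    ∀ ℓ ∈ B.image t, (B.filter (fun b => t b = ℓ) ∪ (Finset.univ \ B).filter (fun p' => t (u p') = ℓ)).Nonempty := by
  intro ℓ hℓ
  obtain ⟨a, ha, rfl⟩ := Finset.mem_image.1 hℓ
  rw [induced_closing_eq B t u hinj huB ha]
  exact ⟨a, Finset.mem_insert_self a _⟩

/-- The closing link lies on every plaquette it closes. [ours] -/
theorem induced_mem_links
    (ht : ∀ p ∈ B, t p ∈ ({(p.1, p.2.1.1), (p.1.shift p.2.1.1, p.2.1.2),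
        (p.1.shift p.2.1.2, p.2.1.1), (p.1, p.2.1.2)} : Finset (Edge d L)))
    (hut : ∀ p' ∈ Finset.univ \ B, t (u p') ∈ ({(p'.1, p'.2.1.1), (p'.1.shift p'.2.1.1, p'.2.1.2),
        (p'.1.shift p'.2.1.2, p'.2.1.1), (p'.1, p'.2.1.2)} : Finset (Edge d L))) :
    ∀ ℓ ∈ B.image t, ∀ p ∈ B.filter (fun b => t b = ℓ) ∪ (Finset.univ \ B).filter (fun p' => t (u p') = ℓ),
      ℓ ∈ ({(p.1, p.2.1.1), (p.1.shift p.2.1.1, p.2.1.2), (p.1.shift p.2.1.2, p.2.1.1), (p.1, p.2.1.2)} :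
        Finset (Edge d L)) := by
  intro ℓ _ p hp
  simp only [Finset.mem_union, Finset.mem_filter] at hp
  rcases hp with ⟨hpB, rfl⟩ | ⟨hpB, rfl⟩
  · exact ht p hpB
  · exact hut p hpB

omit [NeZero L] in
/-- Distinct closing links close disjoint sets. [ours] -/
theorem induced_disjoint [Fintype (Plaquette d L)] :
    ∀ ℓ ∈ B.image t, ∀ ℓ' ∈ B.image t, ℓ ≠ ℓ' →
      Disjoint (B.filter (fun b => t b = ℓ) ∪ (Finset.univ \ B).filter (fun p' => t (u p') = ℓ))
        (B.filter (fun b => t b = ℓ') ∪ (Finset.univ \ B).filter (fun p' => t (u p') = ℓ')) := by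
  intro ℓ _ ℓ' _ hne
  rw [Finset.disjoint_left]
  intro p hp hp'
  simp only [Finset.mem_union, Finset.mem_filter, Finset.mem_sdiff] at hp hp'
  rcases hp with ⟨hpB, h1⟩ | ⟨⟨-, hpB⟩, h1⟩ <;> rcases hp' with ⟨hpB', h2⟩ | ⟨⟨-, hpB'⟩, h2⟩
  · exact hne (h1.symm.trans h2)
  · exact hpB' hpB
  · exact hpB hpB'
  · exact hne (h1.symm.trans h2)

/-- Every plaquette is closed: `a ∈ B` by its own top link, `p' ∉ B` by the top link of `u p'`. [ours] -/
theorem induced_cover (huB : ∀ p' ∈ Finset.univ \ B, u p' ∈ B) :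
    ∀ p : Plaquette d L, ∃ ℓ ∈ B.image t,
      p ∈ B.filter (fun b => t b = ℓ) ∪ (Finset.univ \ B).filter (fun p' => t (u p') = ℓ) := by
  intro p
  by_cases hp : p ∈ B
  · exact ⟨t p, Finset.mem_image_of_mem t hp, Finset.mem_union_left _ (Finset.mem_filter.2 ⟨hp, rfl⟩)⟩
  · have hp' : p ∈ Finset.univ \ B := Finset.mem_sdiff.2 ⟨Finset.mem_univ p, hp⟩
    exact ⟨t (u p), Finset.mem_image_of_mem t (huB p hp'),
      Finset.mem_union_right _ (Finset.mem_filter.2 ⟨hp', rfl⟩)⟩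

omit [NeZero L] in
/-- **`#T = #B`**: as many closing links as covered plaquettes. [ours] -/
theorem card_induced_links (hinj : Set.InjOn t B) : (B.image t).card = B.card :=
  Finset.card_image_of_injOn hinj

/-- **`#C_{t(a)} = n_a + 1`**, `n_a = #u⁻¹(a)`. [ours] -/
theorem card_induced_closing (hinj : Set.InjOn t B) (huB : ∀ p' ∈ Finset.univ \ B, u p' ∈ B) {a : Plaquette d L}
    (ha : a ∈ B) :
    (B.filter (fun b => t b = t a) ∪ (Finset.univ \ B).filter (fun p' => t (u p') = t a)).card =
      ((Finset.univ \ B).filter (fun p' => u p' = a)).card + 1 := by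
  rw [induced_closing_eq B t u hinj huB ha, Finset.card_insert_of_notMem]
  intro h
  exact (Finset.mem_sdiff.1 (Finset.mem_filter.1 h).1).2 ha

/-- **`∏_{ℓ∈T} c_{#C_ℓ} = ∏_{a∈B} c_{n_a+1}`** for the induced assignment. [ours] -/
theorem prod_induced_eq (hinj : Set.InjOn t B) (huB : ∀ p' ∈ Finset.univ \ B, u p' ∈ B) (cst : ℕ → ℝ) :
    ∏ ℓ ∈ B.image t, cst (B.filter (fun b => t b = ℓ) ∪ (Finset.univ \ B).filter (fun p' => t (u p') = ℓ)).card =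
      ∏ a ∈ B, cst (((Finset.univ \ B).filter (fun p' => u p' = a)).card + 1) := by
  rw [Finset.prod_image hinj]
  exact Finset.prod_congr rfl fun a ha => by rw [card_induced_closing B t u hinj huB ha]

end Induced

/-! ## §2 The exact cold-start ratio `η` -/

section Ratio

variable {G : Type*} [Group G] [TopologicalSpace G] [IsTopologicalGroup G]
  [CompactSpace G] [SecondCountableTopology G] [MeasurableSpace G] [BorelSpace G]

omit [NeZero L] [TopologicalSpace G] [IsTopologicalGroup G] [CompactSpace G] [SecondCountableTopology G]
  [BorelSpace G] [Group G] in
/-- **`Z/(c^{#B} M^k) = η · Z/∏_{a∈B} c_{n_a+1}`**, `η = ∏_{a∈B} c_{n_a+1}/(c·M^{n_a})`, `Σ_a n_a = k = #Bᶜ` (pure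
arithmetic; `c, M > 0`, `c_j > 0`). [ours] -/
theorem heatBath_coldRate_eq_eta_mul [Fintype (Plaquette d L)] {c M Z : ℝ} (hc : 0 < c) (hM : 0 < M)
    (cst : ℕ → ℝ) (hcst : ∀ j, 0 < cst j) (B : Finset (Plaquette d L)) (u : Plaquette d L → Plaquette d L)
    (huB : ∀ p' ∈ Finset.univ \ B, u p' ∈ B) :
    Z / (c ^ B.card * M ^ (Finset.univ \ B).card) =
      (∏ a ∈ B, cst (((Finset.univ \ B).filter (fun p' => u p' = a)).card + 1) /
          (c * M ^ ((Finset.univ \ B).filter (fun p' => u p' = a)).card)) *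
        (Z / ∏ a ∈ B, cst (((Finset.univ \ B).filter (fun p' => u p' = a)).card + 1)) := by
  classical
  have hk : (Finset.univ \ B).card = ∑ a ∈ B, ((Finset.univ \ B).filter (fun p' => u p' = a)).card :=
    Finset.card_eq_sum_card_fiberwise fun p' hp' => huB p' hp'
  have hP : 0 < ∏ a ∈ B, cst (((Finset.univ \ B).filter (fun p' => u p' = a)).card + 1) :=
    prod_pos fun a _ => hcst _
  rw [hk, ← Finset.prod_pow_eq_pow_sum, Finset.prod_div_distrib, Finset.prod_mul_distrib, Finset.prod_const]
  field_simp

omit [NeZero L] [SecondCountableTopology G] in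
/-- **`η < 1` as soon as `w` is not constant and some covered plaquette closes an uncovered one** (every factor
`θ_{n_a} ≤ 1`, `ratio_le_one`; a factor with `n_a ≥ 1` is `< 1`, `ratio_lt_one`). [ours] -/
theorem eta_lt_one [Fintype (Plaquette d L)] {w : G → ℝ} (hw : Continuous w) (hw0 : ∀ g, 0 < w g) {M : ℝ}
    (hM : ∀ g, w g ≤ M) {g₀ : G} (hg₀ : w g₀ < M) (B : Finset (Plaquette d L)) (u : Plaquette d L → Plaquette d L)
    {a₀ : Plaquette d L} (ha₀ : a₀ ∈ B) (hn : 1 ≤ ((Finset.univ \ B).filter (fun p' => u p' = a₀)).card) :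
    ∏ a ∈ B, (∫ h, w h ^ (((Finset.univ \ B).filter (fun p' => u p' = a)).card + 1) ∂(haarProbability G)) /
        ((∫ g, w g ∂(haarProbability G)) * M ^ ((Finset.univ \ B).filter (fun p' => u p' = a)).card) < 1 := by
  classical
  have hc : 0 < ∫ g, w g ∂(haarProbability G) := haarProbability_integral_pos_of_continuous_pos hw hw0
  have hMpos : 0 < M := (hw0 1).trans_le (hM 1)
  have hfac0 : ∀ a, 0 ≤ (∫ h, w h ^ (((Finset.univ \ B).filter (fun p' => u p' = a)).card + 1) ∂(haarProbability G)) /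
      ((∫ g, w g ∂(haarProbability G)) * M ^ ((Finset.univ \ B).filter (fun p' => u p' = a)).card) := fun a =>
    div_nonneg (integral_nonneg fun h => pow_nonneg (hw0 h).le _) (mul_pos hc (pow_pos hMpos _)).le
  rw [← Finset.mul_prod_erase B _ ha₀]
  have h1 : (∫ h, w h ^ (((Finset.univ \ B).filter (fun p' => u p' = a₀)).card + 1) ∂(haarProbability G)) /
      ((∫ g, w g ∂(haarProbability G)) * M ^ ((Finset.univ \ B).filter (fun p' => u p' = a₀)).card) < 1 := by
    obtain ⟨n, hn'⟩ : ∃ n, ((Finset.univ \ B).filter (fun p' => u p' = a₀)).card = n + 1 := ⟨_, (Nat.sub_add_cancel hn).symm⟩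
    rw [hn']
    exact ratio_lt_one hw hw0 hM hg₀ n
  have h2 : ∏ a ∈ B.erase a₀, (∫ h, w h ^ (((Finset.univ \ B).filter (fun p' => u p' = a)).card + 1) ∂(haarProbability G)) /
      ((∫ g, w g ∂(haarProbability G)) * M ^ ((Finset.univ \ B).filter (fun p' => u p' = a)).card) ≤ 1 :=
    Finset.prod_le_one (fun a _ => hfac0 a) fun a _ => ratio_le_one hw hw0 hM _
  calc _ ≤ (∫ h, w h ^ (((Finset.univ \ B).filter (fun p' => u p' = a₀)).card + 1) ∂(haarProbability G)) /
      ((∫ g, w g ∂(haarProbability G)) * M ^ ((Finset.univ \ B).filter (fun p' => u p' = a₀)).card) * 1 :=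
        mul_le_mul_of_nonneg_left h2 (hfac0 a₀)
    _ < 1 := by rw [mul_one]; exact h1

/-- **THE EXACT COLD-START RATIO.**  `L ≥ 2`; `w` continuous, `0 < m ≤ w ≤ M = w(1)`, `w(g⁻¹) = w(g)`; `(B, t, rank)`
ranked with a total closing map `u : Bᶜ → B` (`t(u p')` a link of `p'`); `π` the plaquette-weight target; `q_B`
the one-plaquette heat-bath block proposal and `q` the all-closing proposal along the INDUCED assignment
(`T = t(B)`, `C_{t(a)} = {a} ∪ u⁻¹(a)`).  Then the acceptance masses of the two exact samplers at the cold
configuration satisfy `A_{heat bath}(cold) = η · A_{all-closing}(cold)` EXACTLY,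
`η = ∏_{a∈B} c_{n_a+1}/(c·M^{n_a})` (`≤ 1`; `< 1` by `eta_lt_one`). [ours] -/
theorem cold_acceptMass_heatBath_eq_eta_mul_allClosing (hL : 2 ≤ L) {w : G → ℝ} (hw : Continuous w)
    {m M : ℝ} (hm0 : 0 < m) (hm : ∀ g, m ≤ w g) (hM : ∀ g, w g ≤ M) (hw1 : w 1 = M) (hwinv : ∀ g, w g⁻¹ = w g)
    (B : Finset (Plaquette d L)) (t : Plaquette d L → Edge d L)
    (ht : ∀ p ∈ B, t p ∈ ({(p.1, p.2.1.1), (p.1.shift p.2.1.1, p.2.1.2),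
        (p.1.shift p.2.1.2, p.2.1.1), (p.1, p.2.1.2)} : Finset (Edge d L)))
    (rank : Plaquette d L → ℕ)
    (hrank : ∀ p ∈ B, ∀ p' ∈ B, p ≠ p' → t p ∈ ({(p'.1, p'.2.1.1), (p'.1.shift p'.2.1.1, p'.2.1.2),
        (p'.1.shift p'.2.1.2, p'.2.1.1), (p'.1, p'.2.1.2)} : Finset (Edge d L)) → rank p < rank p')
    (u : Plaquette d L → Plaquette d L) (huB : ∀ p' ∈ Finset.univ \ B, u p' ∈ B)
    (hut : ∀ p' ∈ Finset.univ \ B, t (u p') ∈ ({(p'.1, p'.2.1.1), (p'.1.shift p'.2.1.1, p'.2.1.2),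
        (p'.1.shift p'.2.1.2, p'.2.1.1), (p'.1, p'.2.1.2)} : Finset (Edge d L)))
    (π qB q : Measure (GaugeConfig d L G)) [IsProbabilityMeasure π] [IsProbabilityMeasure qB]
    [IsProbabilityMeasure q]
    (hπ : π = (Measure.pi fun _ : Edge d L => haarProbability G).withDensity fun U =>
      ENNReal.ofReal ((∏ p : Plaquette d L, w (plaquetteHolonomy U p.1 p.2.1.1 p.2.1.2)) /
        ∫ V, ∏ p : Plaquette d L, w (plaquetteHolonomy V p.1 p.2.1.1 p.2.1.2) ∂(Measure.pi fun _ : Edge d L => haarProbability G)))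
    (hqB : qB = (Measure.pi fun _ : Edge d L => haarProbability G).withDensity fun U =>
      ENNReal.ofReal ((∏ p ∈ B, w (plaquetteHolonomy U p.1 p.2.1.1 p.2.1.2)) /
        ∫ V, ∏ p ∈ B, w (plaquetteHolonomy V p.1 p.2.1.1 p.2.1.2) ∂(Measure.pi fun _ : Edge d L => haarProbability G)))
    (hq : q = (Measure.pi fun _ : Edge d L => haarProbability G).withDensity fun U =>
      ENNReal.ofReal (∏ ℓ ∈ B.image t,
        (∏ p ∈ B.filter (fun b => t b = ℓ) ∪ (Finset.univ \ B).filter (fun p' => t (u p') = ℓ),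
            w (plaquetteHolonomy U p.1 p.2.1.1 p.2.1.2)) /
          (∫ v, ∏ p ∈ B.filter (fun b => t b = ℓ) ∪ (Finset.univ \ B).filter (fun p' => t (u p') = ℓ),
            w (plaquetteHolonomy (update U ℓ v) p.1 p.2.1.1 p.2.1.2) ∂(haarProbability G)))) :
    (imhAcceptMass qB (fun U =>
        ((∫ V, ∏ p : Plaquette d L, w (plaquetteHolonomy V p.1 p.2.1.1 p.2.1.2) ∂(Measure.pi fun _ : Edge d L => haarProbability G)) /
          ((∫ V, ∏ p ∈ B, w (plaquetteHolonomy V p.1 p.2.1.1 p.2.1.2) ∂(Measure.pi fun _ : Edge d L => haarProbability G)) *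
            ∏ p ∈ Finset.univ \ B, w (plaquetteHolonomy U p.1 p.2.1.1 p.2.1.2)))⁻¹)
        (fun _ : Edge d L => (1 : G))).toReal =
      (∏ a ∈ B, (∫ h, w h ^ (((Finset.univ \ B).filter (fun p' => u p' = a)).card + 1) ∂(haarProbability G)) /
          ((∫ g, w g ∂(haarProbability G)) * M ^ ((Finset.univ \ B).filter (fun p' => u p' = a)).card)) *
      (imhAcceptMass q (fun U =>
        (((∫ V, ∏ p : Plaquette d L, w (plaquetteHolonomy V p.1 p.2.1.1 p.2.1.2) ∂(Measure.pi fun _ : Edge d L => haarProbability G)) /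
          ∏ ℓ ∈ B.image t, (∫ v, ∏ p ∈ B.filter (fun b => t b = ℓ) ∪ (Finset.univ \ B).filter (fun p' => t (u p') = ℓ),
            w (plaquetteHolonomy (update U ℓ v) p.1 p.2.1.1 p.2.1.2) ∂(haarProbability G))))⁻¹)
        (fun _ : Edge d L => (1 : G))).toReal := by
  classical
  have hinj : Set.InjOn t B := injOn_of_ranked B t ht rank hrank
  have hw0 : ∀ g, 0 < w g := fun g => hm0.trans_le (hm g)
  have hMpos : 0 < M := (hw0 1).trans_le (hM 1)
  have hc : 0 < ∫ g, w g ∂(haarProbability G) := haarProbability_integral_pos_of_continuous_pos hw hw0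
  obtain ⟨hA1, -⟩ := heatBath_cold_acceptMass_eq hL hw hm0 hm hM hw1 B t ht rank hrank π qB hπ hqB
  obtain ⟨hA2, -⟩ := allClosing_cold_acceptMass_eq hL hw hm0 hm hM hwinv (B.image t)
    (fun ℓ => B.filter (fun b => t b = ℓ) ∪ (Finset.univ \ B).filter (fun p' => t (u p') = ℓ))
    (induced_nonempty B t u hinj huB) (induced_mem_links B t u ht hut) (induced_disjoint B t u)
    (induced_cover B t u huB) π q hπ hq
  rw [hA1, hA2, prod_induced_eq B t u hinj huB (fun j => ∫ h, w h ^ j ∂(haarProbability G))]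
  exact heatBath_coldRate_eq_eta_mul hc hMpos (fun j => ∫ h, w h ^ j ∂(haarProbability G))
    (fun j => haarProbability_integral_pos_of_continuous_pos (hw.pow j) fun h => pow_pos (hw0 h) j) B u huB

end Ratio

end Summit.Ventures.LatticeQCDFlow.Theory2.Autoregressive

end
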